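import Mathlib
import Literature.Analysis.Calculus.EnergyTailCutoff
import HarnessLib

/-!
# Global `C²` `t`-polynomial solutions of `p_tt − p_xx + P p = 0` on `{x ≥ 1}` from a chain

Analysis/PDE support file (everything proved). Given a continuous potential `P` and a finite chain
of functions `a_0, …, a_j` (`a_{j+1} = 0`), continuous on `ℝ` and `C²` on `(½, ∞)` with

  `a_i'' = P a_i + m_i a_{i+1}`,  `m_i = (2i+π+1)(2i+π+2)`  (`π ∈ {0, 1}`),

the function `p(t,x) = χ(x) Σ_i t^{2i+π} a_i(x)` — `χ` a smooth cutoff, `0` below `5/8`, `1` above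
`3/4` — is globally `C²` in `(t,x)`, equals the `t`-polynomial `Σ_i t^{2i+π} a_i(x)` for `x ≥ 1`,
and solves `p_tt − p_xx + P p = 0` there (`exists_truePolynomial`; the wave identity is the chain
relation after re-indexing `∂_t² t^{2i+π} = (2i+π)(2i+π−1) t^{2i+π−2}`). With the chains of
`InverseSquareTrueChain.lean` these are the TRUE non-radiative kernel elements of the far-side
channel estimate of `FixedModeChannels` (route PhotonSphereChannels,
stmt-FinalStateConjecture-10048); with `P = n(n+1)/x²` and `a_i = c_i x^{2j−n−2i}` they are the
classical ones (Kenig–Lawrie–Liu–Schlag 2015, §1 Remark 5). Folklore.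
-/

noncomputable section

namespace Literature.Analysis.PDE

open Set Filter Topology Finset Literature.Analysis.Calculus

variable {P : ℝ → ℝ} {a a' : ℕ → ℝ → ℝ} {j π : ℕ}

/-- A cut-off `C²`-on-`(½,∞)` function is globally `C²`: if `χ` is smooth and vanishes on
`(−∞, 5/8]` and `f` is `C²` on `(½, ∞)`, then `χ f ∈ C²(ℝ)`. [folklore] -/
theorem contDiff_cutoff_mul {χ f : ℝ → ℝ} (hχ : ContDiff ℝ (⊤ : ℕ∞) χ)
    (hχ0 : ∀ x, x ≤ 5 / 8 → χ x = 0) (hf : ContDiffOn ℝ 2 f (Ioi (1 / 2))) :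
    ContDiff ℝ 2 fun x => χ x * f x := by
  refine contDiff_iff_contDiffAt.2 fun x => ?_
  rcases lt_or_ge (9 / 16 : ℝ) x with hx | hx
  · have hxs : Ioi (1 / 2 : ℝ) ∈ 𝓝 x := Ioi_mem_nhds (by linarith)
    exact (contDiff_infty.1 hχ 2).contDiffAt.mul (hf.contDiffAt hxs)
  · have hev : (fun x => χ x * f x) =ᶠ[𝓝 x] fun _ => 0 :=
      Filter.mem_of_superset (Iio_mem_nhds (by linarith : x < 5 / 8)) fun y hy => by
        show χ y * f y = 0; rw [hχ0 y (le_of_lt hy), zero_mul]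
    exact (contDiffAt_const (c := (0 : ℝ))).congr_of_eventuallyEq hev

/-- **Global `C²` `t`-polynomial true solutions from a chain.** See the module docstring.
[folklore] -/
theorem exists_truePolynomial (hP : Continuous P) (π : ℕ) (hπ : π * (π - 1) = 0)
    (htop : ∀ z, a (j + 1) z = 0) (hcont : ∀ i, i ≤ j → Continuous (a i))
    (hder : ∀ i, i ≤ j → ∀ z, (1 / 2 : ℝ) < z → HasDerivAt (a i) (a' i z) z ∧
      HasDerivAt (a' i) (P z * a i z + ((2 * i + π + 1) * (2 * i + π + 2) : ℕ) * a (i + 1) z) z) :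
    ∃ p : ℝ → ℝ → ℝ, ContDiff ℝ 2 (Function.uncurry p) ∧
      (∀ t z, (7 / 8 : ℝ) ≤ z → p t z = ∑ i ∈ range (j + 1), t ^ (2 * i + π) * a i z) ∧
      (∀ t z, (1 : ℝ) ≤ z →
        iteratedDeriv 2 (fun τ => p τ z) t - iteratedDeriv 2 (p t) z + P z * p t z = 0) ∧
      (∀ t z, (1 : ℝ) ≤ z →
        deriv (fun τ => p τ z) t
            = ∑ i ∈ range (j + 1), ((2 * i + π : ℕ) : ℝ) * t ^ (2 * i + π - 1) * a i z ∧
        deriv (p t) z = ∑ i ∈ range (j + 1), t ^ (2 * i + π) * a' i z) := by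
  -- the cutoff
  obtain ⟨χc, hχcC, hχc1, hχc2, -, -⟩ := exists_smooth_cutoff
  set χ : ℝ → ℝ := fun z => 1 - χc (8 * z - 4) with hχ
  have hχC : ContDiff ℝ (⊤ : ℕ∞) χ :=
    contDiff_const.sub (hχcC.comp ((contDiff_const.mul contDiff_id).sub contDiff_const))
  have hχ0 : ∀ z, z ≤ 5 / 8 → χ z = 0 := fun z hz => by
    simp only [hχ, hχc1 _ (by linarith : 8 * z - 4 ≤ 1), sub_self]
  have hχ1 : ∀ z, 3 / 4 ≤ z → χ z = 1 := fun z hz => by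
    simp only [hχ, hχc2 _ (by linarith : (2 : ℝ) ≤ 8 * z - 4), sub_zero]
  -- regularity of the chain functions on `(1/2, ∞)`
  have hS : IsOpen (Ioi (1 / 2 : ℝ)) := isOpen_Ioi
  have haC2 : ∀ i, i ≤ j → ContDiffOn ℝ 2 (a i) (Ioi (1 / 2)) := by
    intro i hi
    have hc1 : Continuous (a (i + 1)) := by
      rcases Nat.lt_or_ge i j with h | h
      · exact hcont (i + 1) h
      · have : i = j := le_antisymm hi h
        subst this
        have : a (i + 1) = fun _ => 0 := funext htop
        rw [this]; exact continuous_const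
    have hg : ContinuousOn (fun z => P z * a i z
        + ((2 * i + π + 1) * (2 * i + π + 2) : ℕ) * a (i + 1) z) (Ioi (1 / 2)) :=
      ((hP.mul (hcont i hi)).add (continuous_const.mul hc1)).continuousOn
    -- two derivatives on the open set, the second continuous (cf. the tree's
    -- `RadialLoewner.contDiffOn_two_of_hasDerivAt`)
    have h1 : ContDiffOn ℝ 1 (a' i) (Ioi (1 / 2)) := by
      rw [show (1 : WithTop ℕ∞) = 0 + 1 by norm_num, contDiffOn_succ_iff_deriv_of_isOpen hS]
      refine ⟨fun x hx => (hder i hi x hx).2.differentiableAt.differentiableWithinAt,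
        fun h => absurd h (by simp), ?_⟩
      exact (contDiffOn_zero.2 hg).congr fun x hx => (hder i hi x hx).2.deriv
    rw [show (2 : WithTop ℕ∞) = 1 + 1 by norm_num, contDiffOn_succ_iff_deriv_of_isOpen hS]
    refine ⟨fun x hx => (hder i hi x hx).1.differentiableAt.differentiableWithinAt,
      fun h => absurd h (by simp), ?_⟩
    exact h1.congr fun x hx => (hder i hi x hx).1.deriv
  -- the solution
  set p : ℝ → ℝ → ℝ := fun t z => χ z * ∑ i ∈ range (j + 1), t ^ (2 * i + π) * a i z with hp
  have hterm : ∀ i, i ≤ j →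
      ContDiff ℝ 2 fun q : ℝ × ℝ => q.1 ^ (2 * i + π) * (χ q.2 * a i q.2) := by
    intro i hi
    exact (contDiff_fst.pow _).mul ((contDiff_cutoff_mul hχC hχ0 (haC2 i hi)).comp contDiff_snd)
  have hpC : ContDiff ℝ 2 (Function.uncurry p) := by
    have : Function.uncurry p = fun q : ℝ × ℝ => ∑ i ∈ range (j + 1),
        q.1 ^ (2 * i + π) * (χ q.2 * a i q.2) := by
      funext q; simp only [Function.uncurry, hp, Finset.mul_sum]; refine Finset.sum_congr rfl ?_
      intro i _; ring
    rw [this]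
    exact ContDiff.sum fun i hi => hterm i (Nat.lt_succ_iff.1 (mem_range.1 hi))
  -- the explicit form above `7/8`
  have hpform : ∀ t z, (7 / 8 : ℝ) ≤ z → p t z = ∑ i ∈ range (j + 1), t ^ (2 * i + π) * a i z := by
    intro t z hz; simp only [hp, hχ1 z (by linarith), one_mul]
  -- `t`-derivatives above `7/8`
  have hdt : ∀ z, (7 / 8 : ℝ) ≤ z → ∀ t,
      HasDerivAt (fun τ => p τ z)
        (∑ i ∈ range (j + 1), ((2 * i + π : ℕ) : ℝ) * t ^ (2 * i + π - 1) * a i z) t := by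
    intro z hz t
    have e : (fun τ => p τ z) = fun τ => ∑ i ∈ range (j + 1), τ ^ (2 * i + π) * a i z :=
      funext fun τ => hpform τ z hz
    rw [e]
    exact HasDerivAt.fun_sum fun i _ => (hasDerivAt_pow (2 * i + π) t).mul_const (a i z)
  have hdtt : ∀ z, (7 / 8 : ℝ) ≤ z → ∀ t,
      iteratedDeriv 2 (fun τ => p τ z) t = ∑ i ∈ range (j + 1),
        ((2 * i + π : ℕ) : ℝ) * (((2 * i + π - 1 : ℕ) : ℝ) * t ^ (2 * i + π - 1 - 1)) * a i z := by
    intro z hz t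
    rw [iteratedDeriv_succ, iteratedDeriv_one]
    have e : deriv (fun τ => p τ z)
        = fun τ => ∑ i ∈ range (j + 1), ((2 * i + π : ℕ) : ℝ) * τ ^ (2 * i + π - 1) * a i z :=
      funext fun τ => (hdt z hz τ).deriv
    rw [e]
    exact (HasDerivAt.fun_sum fun i _ =>
      ((hasDerivAt_pow (2 * i + π - 1) t).const_mul _).mul_const (a i z)).deriv
  -- `z`-derivatives above `7/8`
  have hploc : ∀ t z, (7 / 8 : ℝ) < z →
      (p t) =ᶠ[𝓝 z] fun y => ∑ i ∈ range (j + 1), t ^ (2 * i + π) * a i y := fun t z hz =>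
    Filter.mem_of_superset (Ioi_mem_nhds hz) fun y hy => hpform t y (le_of_lt hy)
  have hdz : ∀ t z, (7 / 8 : ℝ) < z →
      HasDerivAt (p t) (∑ i ∈ range (j + 1), t ^ (2 * i + π) * a' i z) z := by
    intro t z hz
    refine HasDerivAt.congr_of_eventuallyEq ?_ (hploc t z hz)
    exact HasDerivAt.fun_sum fun i hi =>
      ((hder i (Nat.lt_succ_iff.1 (mem_range.1 hi)) z (by linarith)).1).const_mul _
  have hdzz : ∀ t z, (7 / 8 : ℝ) < z → iteratedDeriv 2 (p t) z = ∑ i ∈ range (j + 1),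
      t ^ (2 * i + π) * (P z * a i z + ((2 * i + π + 1) * (2 * i + π + 2) : ℕ) * a (i + 1) z) := by
    intro t z hz
    rw [iteratedDeriv_succ, iteratedDeriv_one]
    have e : deriv (p t) =ᶠ[𝓝 z] fun y => ∑ i ∈ range (j + 1), t ^ (2 * i + π) * a' i y :=
      Filter.mem_of_superset (Ioi_mem_nhds hz) fun y hy => (hdz t y hy).deriv
    rw [e.deriv_eq]
    exact (HasDerivAt.fun_sum fun i hi =>
      ((hder i (Nat.lt_succ_iff.1 (mem_range.1 hi)) z (by linarith)).2).const_mul _).deriv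
  refine ⟨p, hpC, hpform, fun t z hz => ?_, fun t z hz =>
    ⟨(hdt z (by linarith) t).deriv, (hdz t z (by linarith)).deriv⟩⟩
  -- the wave identity: re-index the chain
  rw [hdtt z (by linarith) t, hdzz t z (by linarith), hpform t z (by linarith), Finset.mul_sum]
  -- first sum: the `i = 0` term vanishes, shift the rest
  rw [Finset.sum_range_succ' (fun i => ((2 * i + π : ℕ) : ℝ)
    * (((2 * i + π - 1 : ℕ) : ℝ) * t ^ (2 * i + π - 1 - 1)) * a i z)]
  have h0 : ((2 * 0 + π : ℕ) : ℝ) * (((2 * 0 + π - 1 : ℕ) : ℝ) * t ^ (2 * 0 + π - 1 - 1)) * a 0 z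
      = 0 := by
    have : ((π : ℕ) : ℝ) * ((π - 1 : ℕ) : ℝ) = 0 := by exact_mod_cast hπ
    simp only [Nat.mul_zero, Nat.zero_add]
    calc (π : ℝ) * (((π - 1 : ℕ) : ℝ) * t ^ (π - 1 - 1)) * a 0 z
        = ((π : ℝ) * ((π - 1 : ℕ) : ℝ)) * t ^ (π - 1 - 1) * a 0 z := by ring
      _ = 0 := by rw [this]; ring
  rw [h0, add_zero]
  -- second sum: the `i = j` term vanishes
  rw [Finset.sum_range_succ (fun i => t ^ (2 * i + π)
    * (P z * a i z + ((2 * i + π + 1) * (2 * i + π + 2) : ℕ) * a (i + 1) z)), htop z, mul_zero,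
    add_zero]
  rw [Finset.sum_range_succ (fun i => P z * (t ^ (2 * i + π) * a i z))]
  -- compare termwise
  have key : ∀ i ∈ range j,
      ((2 * (i + 1) + π : ℕ) : ℝ)
          * (((2 * (i + 1) + π - 1 : ℕ) : ℝ) * t ^ (2 * (i + 1) + π - 1 - 1)) * a (i + 1) z
      - t ^ (2 * i + π) * (P z * a i z + ((2 * i + π + 1) * (2 * i + π + 2) : ℕ) * a (i + 1) z)
      + P z * (t ^ (2 * i + π) * a i z) = 0 := by
    intro i _
    have e1 : 2 * (i + 1) + π - 1 - 1 = 2 * i + π := by omega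
    have e2 : ((2 * (i + 1) + π : ℕ) : ℝ) * ((2 * (i + 1) + π - 1 : ℕ) : ℝ)
        = (((2 * i + π + 1) * (2 * i + π + 2) : ℕ) : ℝ) := by
      have : 2 * (i + 1) + π - 1 = 2 * i + π + 1 := by omega
      rw [this]; push_cast; ring
    rw [e1, ← e2]; ring
  have hsum := Finset.sum_eq_zero key
  rw [Finset.sum_add_distrib, Finset.sum_sub_distrib] at hsum
  linarith [hsum]

end Literature.Analysis.PDE
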